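import Summits.ValiantsHypothesis.ValiantsHypothesis.Theorems.BarrierLeverChowBenchmarkPairsTropicalIterate
import Summits.ValiantsHypothesis.ValiantsHypothesis.Theorems.BarrierLeverChowBenchmarkPairsGTN

/-!
# Route BarrierLever — item 22038 `ChowBenchmarkPairs`, line `moore-peel`: the TANGENTIAL (collision) EXTENSION LEMMA
# and the typed node TANGENT STEP with its kernel arrow to `stub_segmentMeanValue`

Helper file (`--supports stmt-ValiantsHypothesis-22038`; cell valiant-natproofs, rung V4, 𝒟-side benchmark of record;
seat val-np-p4 gen 22).  Closes NO item.

A second degeneration class for the one-point step, complementary to the peeling lemmas (`…Peel*.lean`,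
`…Tropical*.lean`, which send the new point to INFINITY along a torus orbit): here the new point COLLIDES WITH THE BASE
POINT `0` along a direction `u`, i.e. the table is `P ⊔ {x·u}` and we read the LOWEST `x`-power of the determinant.
At `x = 0` the new rows `{new}`, `{a,new}` coincide with the old rows `∅`, `{a}`; subtracting them (a unipotent row
operation) and dividing each new row by `x` gives, at `x = 0`, the TANGENT ROWS
`tanE … none T = [|T| = 1]·u^T`, `tanE … (some a) T = Σ_{c∈T} (|T|−1)!·u_c·P_a^{T∖c}` (`= [θ^T] u·R_a`).

* `det_symbMatrixW_one` — `det M(P ⊔ {X·u}) = X^{n+1} · det (tanMatrixX …)` (old rows constant, divided new rows),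
  and `eval_zero_det_tanMatrixX` — at `X = 0` the latter is `det (tanMatrix …)` (old rows `segE P S T`, tangent rows).
* `det_symbMatrixW_one_ne_zero`, `tangential_extension_finite`, `tangential_extension` — **if the tangent determinant
  `det [old rows; tangent rows]` is nonzero, then all but finitely many / some `x` make `P ⊔ {x·u}` nonsingular** on the
  given columns (any domain `R`, any column family; the lemma needs no threshold or up-set structure).
* TYPED NODE `Stmt.tangentStep`: for every `n` some `n`-point table `P` in `ℂ^{n+1}`, direction `v` and column bijection
  make the tangent determinant of the benchmark window `W_{n+1}` (columns `benchCols (n+1) r`, `r = windowStart (n+2)`)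
  nonzero.  KERNEL ARROW `segmentMeanValue_of_tangentStep : Stmt.tangentStep → ∀ h, SegmentMeanValueAt h` (unfolded verbatim
  as in `ChowBenchmarkGTN.segmentMeanValue_of_gtn` / the line file's `stub_segmentMeanValue`): height `0` directly, height
  `n+1` from the node at `n` by `tangential_extension` and the re-indexing `det_finTable` / `rowIndex` of `…PeelIterate.lean`.

EVIDENCE for the node (seat numerics, exact mod `2^31−1`, folder num/): with generic `P` and generic `v` the tangent
determinant on `W_{n+1}` is nonzero for every `n+1 = 3..16` (num/census1.py scheme `newzero`, num/tangent_check.py); with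
`v = e_0` (the lowest coordinate direction) for every `n+1 = 3..12`; `v = e_c` fails only for the top coordinate at
`n+1 = 4, 8, 11`.  WHY IT MIGHT FAIL: it is the «tangential INJ» — a degeneration of the one-point extension, hence STRONGER than
`stub_segmentMeanValue`; a height at which the tangent rows `u·span{1, R_1, …, R_n}` never complement the old span.
WHY USEFUL: the condition is LINEAR in the direction `u` (the new point enters only through `u·R_b`), and at `u = e_0` the
tangent rows are the old singleton rows read at the shifted columns `T ∖ {0}` (odd codes) — a self-similar structure of the
binary window absent from the generic one-point step.  Companion numerics (memo HOME/val-np-p4/g22/MEMO-…-valnp4-g22.md §3):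
collisions of ALL points (fat points) certify `h ≤ 7` but die from `h = 8` by an explicit up-set mechanism; small clusters
(double points) are nonsingular for every `h ≤ 18`.

WHAT THIS IS NOT: no stub of the line is closed; `Stmt.tangentStep` is a typed CONJECTURE (candidate node) with a kernel arrow;
nothing on crux stmt-ValiantsHypothesis-14610 or on `VP` versus `VNP`.
-/

set_option linter.dupNamespace false

namespace Summit.ValiantsHypothesis.ValiantsHypothesis.Theorems.BarrierLever.ChowBenchmarkPeel

open Finset Polynomial

variable {κ : Type*} [DecidableEq κ]
variable {R : Type*} [CommRing R] {n : ℕ}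

/-! ## 1. Unit weights: the table `P ⊔ {X·u}` and its divided new rows -/

omit [DecidableEq κ] in
/-- For the unit weight the weighted degree is the cardinality. -/
theorem wdeg_one (T : Finset κ) : wdeg (fun _ : κ => 1) T = T.card := by
  simp [wdeg]

/-- The base row of a new row: `{new} ↦ ∅`, `{a,new} ↦ {a}` (the old row it degenerates to at `x = 0`). -/
def baseRow : Option (Fin n) → Row n
  | none => ⟨∅, by simp⟩
  | some a => ⟨{a}, by simp⟩

/-- The new rows minus their base rows, divided by `X`:
`{new} ↦ C(|T|!·u^T)·X^{|T|−1}` (`0` at `T = ∅`), `{a,new} ↦ Σ_{d ⊊ T} C(|d|!|T∖d|!·P_a^d·u^{T∖d})·X^{|T∖d|−1}`. -/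
noncomputable def tanRowX (P : Fin n → κ → R) (u : κ → R) : Option (Fin n) → Finset κ → R[X]
  | none, T => if T = ∅ then 0 else C ((T.card.factorial : R) * ∏ c ∈ T, u c) * X ^ (T.card - 1)
  | some a, T => ∑ d ∈ T.powerset.erase T, C ((d.card.factorial : R) * ((T \ d).card.factorial : R) *
      (∏ c ∈ d, P a c) * ∏ c ∈ T \ d, u c) * X ^ ((T \ d).card - 1)

/-- The TANGENT ROWS (`tanRowX` at `X = 0`): `{new} ↦ [|T| = 1]·|T|!·u^T`,
`{a,new} ↦ Σ_{d ⊊ T, |T∖d| = 1} |d|!·|T∖d|!·P_a^d·u^{T∖d} = Σ_{c∈T} (|T|−1)!·u_c·P_a^{T∖c}`. -/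
def tanE (P : Fin n → κ → R) (u : κ → R) : Option (Fin n) → Finset κ → R
  | none, T => if T.card = 1 then (T.card.factorial : R) * ∏ c ∈ T, u c else 0
  | some a, T => ∑ d ∈ T.powerset.erase T, if (T \ d).card = 1 then
      (d.card.factorial : R) * ((T \ d).card.factorial : R) * (∏ c ∈ d, P a c) * ∏ c ∈ T \ d, u c else 0

/-- Row `{new}` minus row `∅` is `X · tanRowX … none`. -/
theorem segE_one_single_sub (P : Fin n → κ → R) (u : κ → R) (T : Finset κ) :
    segE (symbTableW P u fun _ => 1) {none} T - C (segE P (∅ : Finset (Fin n)) T) = X * tanRowX P u none T := by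
  rw [segE_newW_single, wdeg_one, segE_empty, tanRowX]
  by_cases hT : T = ∅
  · subst hT
    simp
  · rw [if_neg hT, if_neg hT, map_zero, sub_zero]
    have h1 : 1 ≤ T.card := Finset.card_pos.mpr (Finset.nonempty_iff_ne_empty.mpr hT)
    obtain ⟨m, hm⟩ : ∃ m, T.card = m + 1 := ⟨T.card - 1, (Nat.sub_add_cancel h1).symm⟩
    rw [hm, Nat.add_sub_cancel, pow_succ]
    ring

/-- Row `{a,new}` minus row `{a}` is `X · tanRowX … (some a)`. -/
theorem segE_one_pair_sub (P : Fin n → κ → R) (u : κ → R) (a : Fin n) (T : Finset κ) :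
    segE (symbTableW P u fun _ => 1) {some a, none} T - C (segE P {a} T) = X * tanRowX P u (some a) T := by
  rw [segE_newW_pair, segE_singleton, tanRowX, Finset.mul_sum]
  have hTT : T ∈ T.powerset := Finset.mem_powerset.mpr (Finset.Subset.refl T)
  rw [← Finset.add_sum_erase T.powerset _ hTT]
  have htop : C ((T.card.factorial : R) * ((T \ T).card.factorial : R) * (∏ c ∈ T, P a c) * ∏ c ∈ T \ T, u c) *
      X ^ (wdeg (fun _ : κ => 1) (T \ T)) = C ((T.card.factorial : R) * ∏ c ∈ T, P a c) := by
    rw [Finset.sdiff_self, wdeg_one, Finset.card_empty, Nat.factorial_zero, Nat.cast_one, mul_one, Finset.prod_empty,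
      mul_one, pow_zero, mul_one]
  rw [htop, add_sub_cancel_left]
  refine Finset.sum_congr rfl fun d hd => ?_
  rw [wdeg_one]
  have hdT : d ⊆ T := Finset.mem_powerset.mp (Finset.mem_of_mem_erase hd)
  have hne : d ≠ T := Finset.ne_of_mem_erase hd
  have h1 : 1 ≤ (T \ d).card := by
    refine Finset.card_pos.mpr (Finset.sdiff_nonempty.mpr fun h => hne (Finset.Subset.antisymm hdT h))
  obtain ⟨m, hm⟩ : ∃ m, (T \ d).card = m + 1 := ⟨(T \ d).card - 1, (Nat.sub_add_cancel h1).symm⟩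
  rw [hm, Nat.add_sub_cancel, pow_succ]
  ring

/-- `tanRowX` at `X = 0` is the tangent row. -/
theorem eval_zero_tanRowX (P : Fin n → κ → R) (u : κ → R) (o : Option (Fin n)) (T : Finset κ) :
    (tanRowX P u o T).eval 0 = tanE P u o T := by
  cases o with
  | none =>
    rw [tanRowX, tanE]
    by_cases hT : T = ∅
    · subst hT
      simp
    · rw [if_neg hT, eval_mul, eval_C, eval_pow, eval_X]
      have hpos : 1 ≤ T.card := Finset.card_pos.mpr (Finset.nonempty_iff_ne_empty.mpr hT)
      by_cases h1 : T.card = 1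
      · rw [if_pos h1, h1]
        simp
      · rw [if_neg h1, zero_pow (by omega), mul_zero]
  | some a =>
    rw [tanRowX, tanE, eval_finsetSum]
    refine Finset.sum_congr rfl fun d hd => ?_
    rw [eval_mul, eval_C, eval_pow, eval_X]
    have hdT : d ⊆ T := Finset.mem_powerset.mp (Finset.mem_of_mem_erase hd)
    have hne : d ≠ T := Finset.ne_of_mem_erase hd
    have hpos : 1 ≤ (T \ d).card :=
      Finset.card_pos.mpr (Finset.sdiff_nonempty.mpr fun h => hne (Finset.Subset.antisymm hdT h))
    by_cases h1 : (T \ d).card = 1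
    · rw [if_pos h1, h1]
      simp
    · rw [if_neg h1, zero_pow (by omega), mul_zero]

/-! ## 2. The determinant identity `det M(P ⊔ {X·u}) = X^{n+1} · det(tanMatrixX)` -/

/-- Rows of the divided matrix: old rows (constants), divided new rows. -/
noncomputable def tanRowsX (P : Fin n → κ → R) (u : κ → R) (col : Row n ⊕ Option (Fin n) → Finset κ) :
    Row n ⊕ Option (Fin n) → Row n ⊕ Option (Fin n) → R[X]
  | Sum.inl S, j => C (segE P S.1 (col j))
  | Sum.inr o, j => tanRowX P u o (col j)

/-- Old rows (constants) and divided new rows, over `R[X]`, on a column family `col`. -/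
noncomputable def tanMatrixX (P : Fin n → κ → R) (u : κ → R) (col : Row n ⊕ Option (Fin n) → Finset κ) :
    Matrix (Row n ⊕ Option (Fin n)) (Row n ⊕ Option (Fin n)) R[X] :=
  Matrix.of (tanRowsX P u col)

/-- Rows of the tangent matrix: old rows `segE P S T`, tangent rows `tanE P u o T`. -/
def tanRows (P : Fin n → κ → R) (u : κ → R) (col : Row n ⊕ Option (Fin n) → Finset κ) :
    Row n ⊕ Option (Fin n) → Row n ⊕ Option (Fin n) → R
  | Sum.inl S, j => segE P S.1 (col j)
  | Sum.inr o, j => tanE P u o (col j)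

/-- **The tangent matrix**: old rows `segE P S T`, tangent rows `tanE P u o T`, on a column family `col`. -/
def tanMatrix (P : Fin n → κ → R) (u : κ → R) (col : Row n ⊕ Option (Fin n) → Finset κ) :
    Matrix (Row n ⊕ Option (Fin n)) (Row n ⊕ Option (Fin n)) R :=
  Matrix.of (tanRows P u col)

/-- Old rows of the symbolic matrix of `P ⊔ {X·u}` are the old rows of `tanMatrixX`. -/
theorem symbMatrixW_one_inl (P : Fin n → κ → R) (u : κ → R) (T : Row n → Finset κ)
    (U : Option (Fin n) → Finset κ) (S : Row n) (j : Row n ⊕ Option (Fin n)) :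
    symbMatrixW P u (fun _ => 1) T U (Sum.inl S) j = tanMatrixX P u (Sum.elim T U) (Sum.inl S) j := by
  rw [symbMatrixW, Matrix.of_apply, rowSet, segE_symbTableW_old, tanMatrixX, Matrix.of_apply, tanRowsX]

/-- The unipotent row operation «new row minus its base row» gives `X ×` the divided new row of `tanMatrixX`. -/
theorem symbMatrixW_one_inr_sub (P : Fin n → κ → R) (u : κ → R) (T : Row n → Finset κ)
    (U : Option (Fin n) → Finset κ) (o : Option (Fin n)) (j : Row n ⊕ Option (Fin n)) :
    symbMatrixW P u (fun _ => 1) T U (Sum.inr o) j - symbMatrixW P u (fun _ => 1) T U (Sum.inl (baseRow o)) j =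
      X * tanMatrixX P u (Sum.elim T U) (Sum.inr o) j := by
  rw [symbMatrixW, Matrix.of_apply, Matrix.of_apply, tanMatrixX, Matrix.of_apply, tanRowsX]
  cases o with
  | none =>
    rw [rowSet, rowSet, segE_symbTableW_old]
    exact segE_one_single_sub P u _
  | some a =>
    rw [rowSet, rowSet, segE_symbTableW_old]
    exact segE_one_pair_sub P u a _

/-- **`det M(P ⊔ {X·u}) = X^{n+1} · det (tanMatrixX …)`.** -/
theorem det_symbMatrixW_one (P : Fin n → κ → R) (u : κ → R) (T : Row n → Finset κ)
    (U : Option (Fin n) → Finset κ) :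
    (symbMatrixW P u (fun _ => 1) T U).det = X ^ (n + 1) * (tanMatrixX P u (Sum.elim T U)).det := by
  classical
  set MX := symbMatrixW P u (fun _ => 1) T U with hMX
  -- the unipotent row operation as a matrix `E`
  set E : Matrix (Row n ⊕ Option (Fin n)) (Row n ⊕ Option (Fin n)) R[X] :=
    Matrix.fromBlocks 1 0 (Matrix.of fun o S => if S = baseRow o then -1 else 0) 1 with hE
  have hdetE : E.det = 1 := by
    rw [hE, Matrix.det_fromBlocks_zero₁₂, Matrix.det_one, Matrix.det_one, mul_one]
  set v : Row n ⊕ Option (Fin n) → R[X] := Sum.elim (fun _ => 1) (fun _ => X) with hv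
  have hmul : E * MX = Matrix.of fun i j => v i * tanMatrixX P u (Sum.elim T U) i j := by
    refine Matrix.ext fun i j => ?_
    rw [Matrix.mul_apply, Fintype.sum_sum_type, Matrix.of_apply]
    cases i with
    | inl S =>
      have h1 : ∀ S' : Row n, E (Sum.inl S) (Sum.inl S') * MX (Sum.inl S') j =
          if S = S' then MX (Sum.inl S') j else 0 := by
        intro S'
        rw [hE, Matrix.fromBlocks_apply₁₁, Matrix.one_apply]
        split_ifs <;> simp
      have h2 : ∀ o' : Option (Fin n), E (Sum.inl S) (Sum.inr o') * MX (Sum.inr o') j = 0 := by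
        intro o'
        rw [hE, Matrix.fromBlocks_apply₁₂, Matrix.zero_apply, zero_mul]
      rw [Finset.sum_congr rfl fun S' _ => h1 S', Finset.sum_congr rfl fun o' _ => h2 o', Finset.sum_ite_eq,
        if_pos (Finset.mem_univ _), Finset.sum_const_zero, add_zero, hv, Sum.elim_inl, one_mul, hMX,
        symbMatrixW_one_inl]
    | inr o =>
      have h1 : ∀ S' : Row n, E (Sum.inr o) (Sum.inl S') * MX (Sum.inl S') j =
          if S' = baseRow o then -MX (Sum.inl S') j else 0 := by
        intro S'
        rw [hE, Matrix.fromBlocks_apply₂₁, Matrix.of_apply]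
        split_ifs <;> simp
      have h2 : ∀ o' : Option (Fin n), E (Sum.inr o) (Sum.inr o') * MX (Sum.inr o') j =
          if o = o' then MX (Sum.inr o') j else 0 := by
        intro o'
        rw [hE, Matrix.fromBlocks_apply₂₂, Matrix.one_apply]
        split_ifs <;> simp
      rw [Finset.sum_congr rfl fun S' _ => h1 S', Finset.sum_congr rfl fun o' _ => h2 o', Finset.sum_ite_eq',
        if_pos (Finset.mem_univ _), Finset.sum_ite_eq, if_pos (Finset.mem_univ _), hv, Sum.elim_inr,
        neg_add_eq_sub, hMX, symbMatrixW_one_inr_sub]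
  have hdet : (E * MX).det = MX.det := by rw [Matrix.det_mul, hdetE, one_mul]
  rw [← hdet, hmul, Matrix.det_mul_column, hv, Fintype.prod_sum_type]
  simp only [Sum.elim_inl, Sum.elim_inr, Finset.prod_const_one, one_mul, Finset.prod_const, Finset.card_univ,
    Fintype.card_option, Fintype.card_fin]

/-- At `X = 0` the divided matrix is the tangent matrix. -/
theorem eval_zero_det_tanMatrixX (P : Fin n → κ → R) (u : κ → R) (col : Row n ⊕ Option (Fin n) → Finset κ) :
    ((tanMatrixX P u col).det).eval 0 = (tanMatrix P u col).det := by
  rw [← Polynomial.coe_evalRingHom, RingHom.map_det]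
  congr 1
  ext i j
  rw [RingHom.mapMatrix_apply, Matrix.map_apply, Polynomial.coe_evalRingHom]
  cases i with
  | inl S => rw [tanMatrixX, Matrix.of_apply, tanRowsX, tanMatrix, Matrix.of_apply, tanRows, eval_C]
  | inr o => rw [tanMatrixX, Matrix.of_apply, tanRowsX, tanMatrix, Matrix.of_apply, tanRows, eval_zero_tanRowX]

/-! ## 3. The tangential extension lemma -/

section MainT

variable {R : Type*} [CommRing R] [IsDomain R] {n : ℕ}

/-- **If the tangent determinant is nonzero, the symbolic determinant of `P ⊔ {X·u}` is a nonzero polynomial.** -/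
theorem det_symbMatrixW_one_ne_zero (P : Fin n → κ → R) (u : κ → R) (T : Row n → Finset κ)
    (U : Option (Fin n) → Finset κ) (hD : (tanMatrix P u (Sum.elim T U)).det ≠ 0) :
    (symbMatrixW P u (fun _ => 1) T U).det ≠ 0 := by
  rw [det_symbMatrixW_one]
  refine mul_ne_zero (pow_ne_zero _ X_ne_zero) ?_
  intro h0
  apply hD
  rw [← eval_zero_det_tanMatrixX, h0, eval_zero]

/-- **Tangential extension lemma, cofinite form**: if the tangent determinant is nonzero, all but finitely many `x`
make the table `P ⊔ {x·u}` nonsingular on the columns `T ⊔ U`. -/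
theorem tangential_extension_finite (P : Fin n → κ → R) (u : κ → R) (T : Row n → Finset κ)
    (U : Option (Fin n) → Finset κ) (hD : (tanMatrix P u (Sum.elim T U)).det ≠ 0) :
    Set.Finite {x : R | (Matrix.of fun i j : Row n ⊕ Option (Fin n) =>
      segE (adjoin P (fun c => u c * x)) (rowSet i) (Sum.elim T U j)).det = 0} := by
  have hne := det_symbMatrixW_one_ne_zero P u T U hD
  refine (Polynomial.finite_setOf_isRoot hne).subset fun x hx => ?_
  rw [Set.mem_setOf_eq, Polynomial.IsRoot.def, eval_det_symbMatrixW]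
  simp only [pow_one]
  exact hx

/-- **Tangential extension lemma**: if the tangent determinant is nonzero, some `x` makes `P ⊔ {x·u}` nonsingular
(over an infinite domain, e.g. characteristic zero). -/
theorem tangential_extension [Infinite R] (P : Fin n → κ → R) (u : κ → R) (T : Row n → Finset κ)
    (U : Option (Fin n) → Finset κ) (hD : (tanMatrix P u (Sum.elim T U)).det ≠ 0) :
    ∃ x : R, (Matrix.of fun i j : Row n ⊕ Option (Fin n) =>
      segE (adjoin P (fun c => u c * x)) (rowSet i) (Sum.elim T U j)).det ≠ 0 := by
  have hfin := tangential_extension_finite P u T U hD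
  obtain ⟨x, hx⟩ := Set.Infinite.nonempty (Set.Finite.infinite_compl hfin)
  exact ⟨x, hx⟩

end MainT

/-! ## 4. The typed node TANGENT STEP and its kernel arrow to `stub_segmentMeanValue` -/

section Node

open Summit.ValiantsHypothesis.ValiantsHypothesis.Theorems.BarrierLever.MoorePeel (benchCols windowStart)
open Summit.ValiantsHypothesis.ValiantsHypothesis.Theorems.BarrierLever.ChowBenchmarkDual
  (eq_windowStart_of_enumeration)

/-- **CONJECTURE TANGENT STEP** (val-np-p4 g22, 2026-08-28; the «tangential INJ» of the collision degeneration).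
For every `n` there are an `n`-point table `P` in `ℂ^{n+1}`, a direction `v ∈ ℂ^{n+1}` and a bijection `e` of the row
index set `Row n ⊕ Option (Fin n)` with the `r_{n+1} = windowStart (n+2)` benchmark columns such that the TANGENT
DETERMINANT of the window `W_{n+1}` — old rows `segE P S (benchCols …)`, tangent rows `tanE P v o (benchCols …)` — is
nonzero.  By `tangential_extension` the point `x·v` then completes `P` to an `(n+1)`-point table nonsingular on
`W_{n+1}`, i.e. `SegmentMeanValueAt (n+1)` (`segmentMeanValue_of_tangentStep`). -/
def Stmt.tangentStep : Prop :=
  ∀ n : ℕ, ∃ (P : Fin n → Fin (n + 1) → ℂ) (v : Fin (n + 1) → ℂ)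
    (e : (Row n ⊕ Option (Fin n)) ≃ Fin (windowStart (n + 1 + 1))),
    (tanMatrix P v (fun j => benchCols (n + 1) (windowStart (n + 1 + 1)) (e j))).det ≠ 0

/-- Height `0`: the `1 × 1` segment-moment matrix of the empty configuration is `(1)`. -/
theorem segmentMeanValueAt_zero_unfolded :
    ∀ (r : ℕ) (u : Fin r → Finset (Fin 0)), Function.Injective u → (∀ i, (u i).card ≤ 2) →
      (∀ S : Finset (Fin 0), S.card ≤ 2 → ∃ i, u i = S) →
      ∃ P : Fin 0 → Fin 0 → ℂ,
        (Matrix.of fun i j : Fin r =>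
          ∑ g : (↥(benchCols 0 r j) → ↥(u i)), (∏ c : ↥(benchCols 0 r j), P (g c) c) *
            ∏ a : ↥(u i), ((Finset.univ.filter fun c : ↥(benchCols 0 r j) => g c = a).card.factorial : ℂ)).det ≠ 0 := by
  intro r u hu hcard hsurj
  have hr : r = windowStart (0 + 1) := eq_windowStart_of_enumeration u hu hcard hsurj
  have hr1 : r = 1 := by rw [hr]; rfl
  subst hr1
  refine ⟨fun _ _ => 0, ?_⟩
  show (Matrix.of fun i j : Fin 1 => segE (fun _ _ => (0 : ℂ)) (u i) (benchCols 0 1 j)).det ≠ 0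
  rw [Matrix.det_unique, Matrix.of_apply]
  have hu0 : u default = ∅ := Finset.eq_empty_of_isEmpty _
  have hc0 : benchCols 0 1 default = ∅ := Finset.eq_empty_of_isEmpty _
  rw [hu0, segE_empty, if_pos hc0]
  exact one_ne_zero

/-- **TANGENT STEP ⟹ `∀ h, SegmentMeanValueAt h`** (the line file's `Stmt.stub_segmentMeanValue`, unfolded verbatim as
in `ChowBenchmarkGTN.segmentMeanValue_of_gtn`). -/
theorem segmentMeanValue_of_tangentStep (H : Stmt.tangentStep) : ∀ h : ℕ,
    ∀ (r : ℕ) (u : Fin r → Finset (Fin h)), Function.Injective u → (∀ i, (u i).card ≤ 2) →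
      (∀ S : Finset (Fin h), S.card ≤ 2 → ∃ i, u i = S) →
      ∃ P : Fin h → Fin h → ℂ,
        (Matrix.of fun i j : Fin r =>
          ∑ g : (↥(benchCols h r j) → ↥(u i)), (∏ c : ↥(benchCols h r j), P (g c) c) *
            ∏ a : ↥(u i),
              ((Finset.univ.filter fun c : ↥(benchCols h r j) => g c = a).card.factorial : ℂ)).det ≠ 0 := by
  intro h
  cases h with
  | zero => exact segmentMeanValueAt_zero_unfolded
  | succ n =>
    intro r u hu hcard hsurj
    have hr : r = windowStart (n + 1 + 1) := eq_windowStart_of_enumeration u hu hcard hsurj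
    subst hr
    obtain ⟨P, v, e, hD⟩ := H n
    set col : Row n ⊕ Option (Fin n) → Finset (Fin (n + 1)) :=
      fun j => benchCols (n + 1) (windowStart (n + 1 + 1)) (e j) with hcol
    have hsplit : Sum.elim (col ∘ Sum.inl) (col ∘ Sum.inr) = col := Sum.elim_comp_inl_inr col
    have hD' : (tanMatrix P v (Sum.elim (col ∘ Sum.inl) (col ∘ Sum.inr))).det ≠ 0 := by rwa [hsplit]
    obtain ⟨x, hx⟩ := tangential_extension P v (col ∘ Sum.inl) (col ∘ Sum.inr) hD'
    rw [hsplit] at hx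
    -- re-index: `Fin (n+1)` points (`finTable`) and `Row (n+1)` rows (`rowEquiv`)
    set P' : Option (Fin n) → Fin (n + 1) → ℂ := adjoin P (fun c => v c * x) with hP'
    have hA := det_finTable P' col
    refine ⟨finTable P', ?_⟩
    -- the node's matrix `N` (rows enumerated by `u`) versus ours (rows `Row (n+1)`, columns permuted through `e`)
    set σ := rowIndex u hu hcard hsurj with hσ
    have hval : ∀ i, (σ i).1 = u i := fun i => rfl
    set τ : Row (n + 1) ≃ Fin (windowStart (n + 1 + 1)) := (rowEquiv n).symm.trans e with hτ
    set N : Matrix (Fin (windowStart (n + 1 + 1))) (Fin (windowStart (n + 1 + 1))) ℂ :=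
      Matrix.of fun i j => segE (finTable P') (u i) (benchCols (n + 1) (windowStart (n + 1 + 1)) j) with hN
    intro hN0
    have hN0' : N.det = 0 := hN0
    apply hx
    rw [← hA]
    have hAmat : (Matrix.of fun S S' : Row (n + 1) => segE (finTable P') S.1 (col ((rowEquiv n).symm S'))) =
        (N.submatrix σ.symm σ.symm).submatrix id (τ.trans σ) := by
      refine Matrix.ext fun S S' => ?_
      simp only [Matrix.submatrix_apply, id_eq, hN, Matrix.of_apply, Equiv.trans_apply, Equiv.symm_apply_apply]
      rw [← hval (σ.symm S), Equiv.apply_symm_apply]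
      rfl
    rw [hAmat, Matrix.det_permute', Matrix.det_submatrix_equiv_self, hN0', mul_zero]

end Node

/-! ## 5. Sharpness of the collision step: a singleton column is necessary -/

section Sharp

variable {R : Type*} [CommRing R] {n : ℕ}

/-- The tangent row `{new}` lives on the singleton columns: it vanishes at every column of cardinality `≠ 1`. -/
theorem tanE_none_eq_zero (P : Fin n → κ → R) (u : κ → R) (T : Finset κ) (hT : T.card ≠ 1) :
    tanE P u none T = 0 := by
  rw [tanE, if_neg hT]

/-- **Sharpness (scope of the node).**  If NO column of the family is a singleton, the tangent determinant vanishes for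
every table and every direction: the collision step `tangential_extension` can only be used on column families containing a
singleton column (the benchmark window `W_h` contains all of them; a GTN family through `∅` need not). -/
theorem det_tanMatrix_eq_zero_of_forall_card_ne_one (P : Fin n → κ → R) (u : κ → R)
    (col : Row n ⊕ Option (Fin n) → Finset κ) (hcol : ∀ j, (col j).card ≠ 1) :
    (tanMatrix P u col).det = 0 := by
  apply Matrix.det_eq_zero_of_row_eq_zero (Sum.inr none)
  intro j
  rw [tanMatrix, Matrix.of_apply, tanRows]
  exact tanE_none_eq_zero P u (col j) (hcol j)

end Sharp

end Summit.ValiantsHypothesis.ValiantsHypothesis.Theorems.BarrierLever.ChowBenchmarkPeel
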